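import Literature.NumberTheory.EllipticCurves.PAdicMeasureMomentsDetermineUnits
import Literature.NumberTheory.EllipticCurves.ProfiniteGroupDistributionTwist
import HarnessLib

/-!
# Bounded distributions on a group along a subgroup tower: the ONE-variable push-forward along a
# tower-continuous `z : G → ℤ_p` with a weight, and vanishing on the `z`-cells from vanishing unit
# moments (de Shalit 1987, II.4.12 Remark (iv) / II.4.17: uniqueness read on a `ℤ_p`-quotient)

De Shalit II.4.17 (p. 77–78) reads a measure on `𝒢 = Gal(K(𝔣p^∞)/K)` on the `ℤ_p`-quotients cut out
by the `𝔭`-adic characters; II.4.12 Remark (iv) (p. 67): a measure is determined by its integrals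
against enough characters. `DeShalit1987/KatzDistributionFromLMeasure.lean` (`katzDistribution₂`)
pushes a `GroupDistribution` on `Γ_K` forward along the TWO additive coordinates `(κ₁, κ₂)` to
`ℤ_p²` (align the levels, twist by an avatar, `map`). THIS file is the ONE-variable twin for an
ARBITRARY tower-continuous `z : G → ℤ_[p]` (e.g. `σ ↦ e₂(κ_v σ)⁻¹` on a coset of `Gal(K̄/K(𝔪))`,
extended by a constant) and an arbitrary bounded tower-continuous WEIGHT `w : G → 𝕜` (e.g. the
indicator of that coset times a locally constant Fourier factor), over any group `G`:

* §1 alignment: `exists_level_toZModPow_comp_eq` (tower-continuity of `z` ⇒ on deep cosets `z` is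
  constant mod `pⁿ`), the reindexing `padicLevelSeq` (strictly increasing) and the level maps
  `padicLevelMap : G ⧸ U_{ψ n} → ℤ/pⁿ` over which `z` lies, compatible with the transitions;
* §2 ★ `pushforwardPadic D hz w hw hC0 hC : BoundedDistribution (ProfiniteTower.padicInt p) 𝕜`
  (`= ((D.reindex ψ).twist w).map levelMap`), its bound `‖D‖·C`, and the change of variables
  ★ `integral_pushforwardPadic : ∫_{ℤ_p} F d(z_*(w·D)) = ∫_G F(z σ)·w(σ) dD(σ)` for `F` uniformly
  continuous and bounded;
* §3 ★★ `integral_cellInd_comp_mul_eq_zero_of_forall_le` — **if `∫_G 𝟙_{ℤ_pˣ}(zσ)·(zσ)^j·w(σ) dD = 0`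
  for all `j ≥ m₀`, then `∫_G 𝟙_{zσ ≡ a (pⁿ)}·w(σ) dD = 0` for every `n ≥ 1` and every unit residue
  `a`** — brick 1 of the `j = 0` uniqueness (`BoundedDistribution.μ_eq_zero_of_isUnit_of_forall_le`,
  `PAdicMeasureMomentsDetermineUnits.lean`) transported to the group through §2; the push-forward
  does not appear in the statement.

Everything is a definition with a body or a theorem; no named facts, no instances, no `sorry`.

## References

* [deShalit1987] E. de Shalit, *Iwasawa theory of elliptic curves with complex multiplication* (1987),
  I.3.1 (p. 15–16), II.4.12 Remark (iv) (p. 67), II.4.17 (p. 77–78).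
* [MazurTateTeitelbaum1986Invent] B. Mazur, J. Tate, J. Teitelbaum, Invent. Math. 84 (1986), §I.11.
* [Washington1997] L. C. Washington, *Introduction to Cyclotomic Fields*, §7.2.
-/

noncomputable section

open Filter
open scoped Topology Classical

namespace Literature.NumberTheory.EllipticCurves

namespace GroupDistribution

variable {p : ℕ} [Fact p.Prime] {G : Type*} [Group G] {𝒰 : SubgroupTower G} {z : G → ℤ_[p]}

/-! ### §1. Aligning the levels of `𝒰` with the congruence levels of `z` -/

/-- A dominating strictly increasing sequence: for any `r : ℕ → ℕ` there is a strictly increasing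
`ψ` with `r n ≤ ψ n`. [folklore] -/
private theorem exists_strictMono_ge' (r : ℕ → ℕ) : ∃ ψ : ℕ → ℕ, StrictMono ψ ∧ ∀ n, r n ≤ ψ n := by
  refine ⟨fun n ↦ (∑ k ∈ Finset.range (n + 1), r k) + n, ?_, fun n ↦ ?_⟩
  · refine strictMono_nat_of_lt_succ fun n ↦ ?_
    rw [Finset.sum_range_succ _ (n + 1)]
    omega
  · have h : r n ≤ ∑ k ∈ Finset.range (n + 1), r k :=
      Finset.single_le_sum (f := r) (fun _ _ ↦ Nat.zero_le _) (Finset.self_mem_range_succ n)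
    dsimp only
    omega

/-- **Congruence levels of `z`**: if `z : G → ℤ_p` is tower-continuous along `𝒰`, then for every `n`
there is a level `N` such that `z` is constant modulo `pⁿ` on each `U_N`-coset.
[cite: deShalit1987, II.4.17 (p. 77–78)] -/
theorem exists_level_toZModPow_comp_eq (hz : 𝒰.IsTowerContinuous z) (n : ℕ) :
    ∃ N : ℕ, ∀ σ τ : G, 𝒰.proj N σ = 𝒰.proj N τ →
      PadicInt.toZModPow n (z σ) = PadicInt.toZModPow n (z τ) := by
  have hp : (0 : ℝ) < (p : ℝ) ^ (-(n : ℤ)) := by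
    have : (0 : ℝ) < p := by exact_mod_cast (Fact.out : p.Prime).pos
    positivity
  obtain ⟨N, hN⟩ := hz _ hp
  refine ⟨N, fun σ τ h ↦ ?_⟩
  have hd := hN N le_rfl σ τ h
  rw [dist_eq_norm] at hd
  exact toZModPow_eq_of_norm_sub_le hd.le

/-- **The aligning reindexing** of `𝒰` for `z`: a strictly increasing `ψ` such that `z` is constant
modulo `pⁿ` on each `U_{ψ n}`-coset (a choice). [cite: deShalit1987, II.4.17 (p. 77–78)] -/
def padicLevelSeq (hz : 𝒰.IsTowerContinuous z) : ℕ → ℕ :=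
  Classical.choose (exists_strictMono_ge' fun n ↦ Classical.choose (exists_level_toZModPow_comp_eq hz n))

/-- The aligning reindexing is strictly increasing. [cite: deShalit1987, II.4.17 (p. 77–78)] -/
theorem strictMono_padicLevelSeq (hz : 𝒰.IsTowerContinuous z) : StrictMono (padicLevelSeq hz) :=
  (Classical.choose_spec (exists_strictMono_ge' fun n ↦
    Classical.choose (exists_level_toZModPow_comp_eq hz n))).1

/-- Along the aligned tower, `z` is constant modulo `pⁿ` on each level-`n` coset.
[cite: deShalit1987, II.4.17 (p. 77–78)] -/
theorem toZModPow_comp_eq_of_proj_padicLevelSeq_eq (hz : 𝒰.IsTowerContinuous z) {n : ℕ} {σ τ : G}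
    (h : 𝒰.proj (padicLevelSeq hz n) σ = 𝒰.proj (padicLevelSeq hz n) τ) :
    PadicInt.toZModPow n (z σ) = PadicInt.toZModPow n (z τ) := by
  have hge := (Classical.choose_spec (exists_strictMono_ge' fun n ↦
    Classical.choose (exists_level_toZModPow_comp_eq hz n))).2 n
  exact Classical.choose_spec (exists_level_toZModPow_comp_eq hz n) σ τ (𝒰.proj_eq_of_proj_eq hge h)

/-- **The level maps `σ U_{ψ n} ↦ z(σ) mod pⁿ`** from the aligned tower to the cells `ℤ/pⁿ` of the
`p`-adic tower. [cite: deShalit1987, II.4.17 (p. 77–78)] -/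
def padicLevelMap (hz : 𝒰.IsTowerContinuous z) (n : ℕ) :
    G ⧸ (𝒰.reindex (padicLevelSeq hz) (strictMono_padicLevelSeq hz).monotone).U n →
      (ProfiniteTower.padicInt p).Cell n :=
  fun a ↦ Quotient.liftOn' a (fun σ ↦ (ProfiniteTower.padicInt p).proj n (z σ))
    fun σ τ hστ ↦ toZModPow_comp_eq_of_proj_padicLevelSeq_eq hz
      (Quotient.sound' hστ : 𝒰.proj (padicLevelSeq hz n) σ = 𝒰.proj (padicLevelSeq hz n) τ)

/-- `z` lies over the level maps: `z(σ) mod pⁿ = padicLevelMap n (σ U_{ψ n})`.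
[cite: deShalit1987, II.4.17 (p. 77–78)] -/
theorem proj_comp_eq_padicLevelMap (hz : 𝒰.IsTowerContinuous z) (n : ℕ) (σ : G) :
    (ProfiniteTower.padicInt p).proj n (z σ) =
      padicLevelMap hz n
        ((𝒰.reindex (padicLevelSeq hz) (strictMono_padicLevelSeq hz).monotone).proj n σ) :=
  rfl

/-- The level maps are compatible with the transition maps. [cite: deShalit1987, II.4.17 (p. 77–78)] -/
theorem padicLevelMap_trans (hz : 𝒰.IsTowerContinuous z) (n : ℕ)
    (b : G ⧸ (𝒰.reindex (padicLevelSeq hz) (strictMono_padicLevelSeq hz).monotone).U (n + 1)) :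
    padicLevelMap hz n
        ((𝒰.reindex (padicLevelSeq hz) (strictMono_padicLevelSeq hz).monotone).trans n b) =
      (ProfiniteTower.padicInt p).trans n (padicLevelMap hz (n + 1) b) := by
  induction b using QuotientGroup.induction_on with
  | H σ =>
    change padicLevelMap hz n ((𝒰.reindex _ _).trans n ((𝒰.reindex _ _).proj (n + 1) σ)) =
      (ProfiniteTower.padicInt p).trans n ((ProfiniteTower.padicInt p).proj (n + 1) (z σ))
    rw [SubgroupTower.trans_proj, ProfiniteTower.trans_proj]
    rfl

/-! ### §2. The push-forward `z_*(w·D)` on `ℤ_p` and its integrals -/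

section Pushforward

variable {𝕜 : Type*} [NormedField 𝕜] [IsUltrametricDist 𝕜] [CompleteSpace 𝕜]
  (D : GroupDistribution 𝒰 𝕜) (hz : 𝒰.IsTowerContinuous z)
  (w : G → 𝕜) (hw : 𝒰.IsTowerContinuous w) {C : ℝ} (hC0 : 0 ≤ C) (hC : ∀ σ, ‖w σ‖ ≤ C)

/-- ★ **The one-variable push-forward `z_*(w·D)`**: reindex `D` along the congruence levels of `z`,
twist by the weight `w`, and push forward along `σ ↦ z(σ) mod pⁿ` — a bounded distribution on `ℤ_p`
(the one-variable twin of `katzDistribution₂`). [cite: deShalit1987, II.4.17 (p. 77–78)] [cite: MazurTateTeitelbaum1986Invent, §I.11] -/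
def pushforwardPadic : BoundedDistribution (ProfiniteTower.padicInt p) 𝕜 :=
  ((D.reindex (padicLevelSeq hz) (strictMono_padicLevelSeq hz).monotone).twist w
      (hw.reindex (strictMono_padicLevelSeq hz)) hC0 hC).map (padicLevelMap hz) (padicLevelMap_trans hz)

/-- The bound of the push-forward is `‖D‖ · C`. [cite: deShalit1987, I.3.1 (p. 15–16)] -/
@[simp] theorem pushforwardPadic_bound : (D.pushforwardPadic hz w hw hC0 hC).bound = D.bound * C := by
  simp [pushforwardPadic]

/-- ★ **Change of variables**: `∫_{ℤ_p} F d(z_*(w·D)) = ∫_G F(z σ)·w(σ) dD(σ)` for `F` uniformly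
continuous and bounded. [cite: deShalit1987, II.4.17 (p. 77–78)] [cite: MazurTateTeitelbaum1986Invent, §I.11] -/
theorem integral_pushforwardPadic {F : ℤ_[p] → 𝕜} (hF : UniformContinuous F) {M : ℝ}
    (hM : ∀ x, ‖F x‖ ≤ M) :
    (D.pushforwardPadic hz w hw hC0 hC).integral F = D.integral (fun σ ↦ F (z σ) * w σ) := by
  have hψ := strictMono_padicLevelSeq hz
  rw [pushforwardPadic, GroupDistribution.integral_map _ _ _ (proj_comp_eq_padicLevelMap hz) hF,
    GroupDistribution.integral_twist _ _ _ _ _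
      ((𝒰.reindex _ hψ.monotone).isTowerContinuous_comp_of_over (padicLevelMap hz)
        (proj_comp_eq_padicLevelMap hz) hF) (fun σ ↦ hM _)]
  exact D.integral_reindex hψ
    ((hz.comp_uniformContinuous hF).mul hw (M := max M C) (fun σ ↦ (hM _).trans (le_max_left _ _))
      (fun σ ↦ (hC σ).trans (le_max_right _ _)))

/-- The level data of the push-forward read as integrals on the group:
`(z_*(w·D))_n(a) = ∫_G 𝟙_{z σ ≡ a (pⁿ)}·w(σ) dD(σ)`. [cite: deShalit1987, II.4.17 (p. 77–78)] -/
theorem pushforwardPadic_μ_eq_integral (n : ℕ) (a : ZMod (p ^ n)) :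
    (D.pushforwardPadic hz w hw hC0 hC).μ n a = D.integral (fun σ ↦ cellInd (𝕜 := 𝕜) n a (z σ) * w σ) := by
  rw [← BoundedDistribution.integral_cellInd,
    D.integral_pushforwardPadic hz w hw hC0 hC (uniformContinuous_cellInd n a) (M := 1)
      (fun x ↦ norm_cellInd_le n a x)]

/-! ### §3. Vanishing on the `z`-cells from vanishing unit moments -/

end Pushforward

section Vanishing

variable {𝕜 : Type*} [NormedField 𝕜] [IsUltrametricDist 𝕜] [CompleteSpace 𝕜] [NormedAlgebra ℚ_[p] 𝕜]
  (D : GroupDistribution 𝒰 𝕜) (w : G → 𝕜)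

omit [IsUltrametricDist 𝕜] [CompleteSpace 𝕜] in
/-- The weighted unit moment integrand `𝟙_{ℤ_pˣ}(x)·x^j` is uniformly continuous on `ℤ_p` and of norm
`≤ 1`. [cite: Washington1997, §7.2] -/
theorem uniformContinuous_unitInd_mul_pow_and_norm_le (j : ℕ) :
    UniformContinuous (fun x : ℤ_[p] ↦ (if IsUnit x then (1 : 𝕜) else 0) * padicIntCast 𝕜 x ^ j) ∧
      ∀ x : ℤ_[p], ‖(if IsUnit x then (1 : 𝕜) else 0) * padicIntCast 𝕜 x ^ j‖ ≤ 1 := by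
  refine ⟨BoundedDistribution.uniformContinuous_mul_padicIntCast_pow
    BoundedDistribution.uniformContinuous_unitInd j, fun x ↦ ?_⟩
  rw [norm_mul, norm_pow, norm_padicIntCast]
  have h1 : ‖(if IsUnit x then (1 : 𝕜) else 0)‖ ≤ 1 := by split_ifs <;> simp
  exact mul_le_one₀ h1 (pow_nonneg (norm_nonneg _) _) (pow_le_one₀ (norm_nonneg _) (PadicInt.norm_le_one x))

/-- ★★ **Vanishing on the `z`-cells from vanishing unit moments.** Let `D` be a bounded distribution on
`G` along `𝒰`, `z : G → ℤ_p` tower-continuous, `w` a bounded tower-continuous weight. If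
`∫_G 𝟙_{ℤ_pˣ}(z σ)·(z σ)^j·w(σ) dD(σ) = 0` for every `j ≥ m₀`, then for every `n ≥ 1` and every UNIT
residue `a mod pⁿ`: `∫_G 𝟙_{z σ ≡ a (pⁿ)}·w(σ) dD(σ) = 0` — brick 1 of the `j = 0` uniqueness
(`BoundedDistribution.μ_eq_zero_of_isUnit_of_forall_le`: a distribution on `ℤ_p` with vanishing unit
moments from `m₀` on vanishes on the unit cells) applied to `z_*(w·D)`.
[cite: deShalit1987, II.4.12 Remark (iv) (p. 67), II.4.17 (p. 77–78)] [cite: Washington1997, §7.2] -/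
theorem integral_cellInd_comp_mul_eq_zero_of_forall_le (hz : 𝒰.IsTowerContinuous z)
    (hw : 𝒰.IsTowerContinuous w) {C : ℝ} (hC0 : 0 ≤ C) (hC : ∀ σ, ‖w σ‖ ≤ C) (m₀ : ℕ)
    (hm : ∀ j : ℕ, m₀ ≤ j →
      D.integral (fun σ ↦ (if IsUnit (z σ) then (1 : 𝕜) else 0) * padicIntCast 𝕜 (z σ) ^ j * w σ) = 0)
    {n : ℕ} (hn : 1 ≤ n) {a : ZMod (p ^ n)} (ha : IsUnit a) :
    D.integral (fun σ ↦ cellInd (𝕜 := 𝕜) n a (z σ) * w σ) = 0 := by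
  rw [← D.pushforwardPadic_μ_eq_integral hz w hw hC0 hC n a]
  refine BoundedDistribution.μ_eq_zero_of_isUnit_of_forall_le _ m₀ (fun j hj ↦ ?_) hn ha
  obtain ⟨hF, hF1⟩ := uniformContinuous_unitInd_mul_pow_and_norm_le (p := p) (𝕜 := 𝕜) j
  rw [D.integral_pushforwardPadic hz w hw hC0 hC hF (M := 1) hF1]
  exact hm j hj

/-- The same conclusion for the indicator written out: `∫_G 𝟙_{z σ ≡ a (pⁿ)}·w(σ) dD(σ) = 0` with
`𝟙` as an `if`. [cite: deShalit1987, II.4.12 Remark (iv) (p. 67)] -/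
theorem integral_ite_toZModPow_comp_mul_eq_zero_of_forall_le (hz : 𝒰.IsTowerContinuous z)
    (hw : 𝒰.IsTowerContinuous w) {C : ℝ} (hC0 : 0 ≤ C) (hC : ∀ σ, ‖w σ‖ ≤ C) (m₀ : ℕ)
    (hm : ∀ j : ℕ, m₀ ≤ j →
      D.integral (fun σ ↦ (if IsUnit (z σ) then (1 : 𝕜) else 0) * padicIntCast 𝕜 (z σ) ^ j * w σ) = 0)
    {n : ℕ} (hn : 1 ≤ n) {a : ZMod (p ^ n)} (ha : IsUnit a) :
    D.integral (fun σ ↦ (if PadicInt.toZModPow n (z σ) = a then (1 : 𝕜) else 0) * w σ) = 0 :=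
  D.integral_cellInd_comp_mul_eq_zero_of_forall_le w hz hw hC0 hC m₀ hm hn ha

end Vanishing

end GroupDistribution

end Literature.NumberTheory.EllipticCurves

end
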